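import Summits.CriticalPhenomena.Ising3DConformalLimit.Theorems.IsingEuclidUpgradeR2RotInvPowerLaw.Negative.GaugeBookkeeping
import HarnessLib

/-!
# Crux `IsingEuclidUpgradeR2RotInvPowerLaw` (stmt-CriticalPhenomena-0634) — negative-side support, I: the log₂-periodic gauge (W2)

Standing crux disprover (cdisprove cycle 1, 2026-08-17), THEOREM-ONLY file; finding F2 of
`Cruxes/IsingEuclidUpgradeR2RotInvPowerLaw/Disproof.lean`, split off for landing.

Write the stubs of line `tower_profile_rigidity` MODEL-BLIND, i.e. for a function `G : Site 3 → ℝ` in place of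
`criticalTwoPoint 3`: T1 (dyadic tower law), S2 (integer dilation law at `Δ`), S3 (ratio isotropy), A (angular
profile, here with `Ψ ≡ 1`), the crux shape, and the tree's envelope `c‖x‖⁻² ≤ G ≤ C‖x‖⁻¹`.

**Witness W2** (introduced through defining hypotheses `hh`, `hG`, no definitions): the radial-by-floor kernel
`G x = h ⌊|x|₂⌋` with the log₂-PERIODIC axis gauge `h n = (2 + cos (2π log₂ n))/n`. It is positive, cubic
symmetric, in the envelope (`‖x‖⁻²/2 ≤ G ≤ 6‖x‖⁻¹`), satisfies T1 EXACTLY (`G(2^j e₀)·2^j = 3`), S3 and A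
IDENTICALLY — and violates S2 at `k = 3` for EVERY exponent `Δ` and the crux.

* `lp_integerDilationLaw_not_of_tower_isotropy_envelope` — {positivity, symmetry, envelope, T1, S3, A} ⊬ S2.
* `lp_crux_not_of_tower_isotropy_envelope` — {positivity, symmetry, envelope, T1, S3, A} ⊬ crux shape.

Reading for the provers: the exponent-purity content of S2 / Sray — exclusion of a `log 2`-commensurable
log-periodic modulation, i.e. of a COMPLEX scaling dimension `Δ ± iπ/log 2` — is invisible to T1, S3, A and the
envelope; it is where the Ising hypothesis must enter a proof of `stub_integerDilationLaw` / `stub_rayDilationLaw`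
(the first informative dilation is `k = 3`; all `k = 2^i` are consistent with W2).
-/

noncomputable section

namespace Summit.CriticalPhenomena.Ising3DConformalLimit.Theorems.IsingEuclidUpgradeR2RotInvPowerLaw.Negative

open Filter Topology Literature.Probability.LatticeModels
open Summit.CriticalPhenomena.Ising3DConformalLimit.Theorems.GapForcesFarMerging.Negative (one_le_norm_of_ne_zero)
open Summit.CriticalPhenomena.Ising3DConformalLimit.JoiningsTransferNegative (cos_two_pi_logb_two_three_ne_one)
open Summit.CriticalPhenomena.Ising3DConformalLimit.Cruxes.DirectCorrelationStableTail.DiffusiveBranchIsNonsaturation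
  (expWin_norm_le_euclid expWin_euclid_le_sqrt_three_mul_norm)

/-! ## The gauge `h n = (2 + cos (2π log₂ n))/n` (hypothesis `hh`; value at `0` := value at `1`) -/

/-- The gauge off `0`. -/
theorem lp_of_one_le {h : ℕ → ℝ} (hh : ∀ n : ℕ, h n = (2 + Real.cos (2 * Real.pi * Real.logb 2 ((max n 1 : ℕ) : ℝ))) / ((max n 1 : ℕ) : ℝ)) {n : ℕ} (hn : 1 ≤ n) :
    h n = (2 + Real.cos (2 * Real.pi * Real.logb 2 (n : ℝ))) / (n : ℝ) := by
  simp [hh, max_eq_left hn]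

/-- The gauge is positive. -/
theorem lp_pos {h : ℕ → ℝ} (hh : ∀ n : ℕ, h n = (2 + Real.cos (2 * Real.pi * Real.logb 2 ((max n 1 : ℕ) : ℝ))) / ((max n 1 : ℕ) : ℝ)) (n : ℕ) : 0 < h n := by
  rw [hh]
  apply div_pos
  · have := Real.neg_one_le_cos (2 * Real.pi * Real.logb 2 ((max n 1 : ℕ) : ℝ))
    linarith
  · exact_mod_cast (le_max_right n 1)

/-- Upper gauge bound `h n ≤ 3 / max n 1`. -/
theorem lp_le {h : ℕ → ℝ} (hh : ∀ n : ℕ, h n = (2 + Real.cos (2 * Real.pi * Real.logb 2 ((max n 1 : ℕ) : ℝ))) / ((max n 1 : ℕ) : ℝ)) (n : ℕ) : h n ≤ 3 / ((max n 1 : ℕ) : ℝ) := by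
  rw [hh]
  gcongr
  have := Real.cos_le_one (2 * Real.pi * Real.logb 2 ((max n 1 : ℕ) : ℝ))
  linarith

/-- Lower gauge bound `1 / max n 1 ≤ h n`. -/
theorem le_lp {h : ℕ → ℝ} (hh : ∀ n : ℕ, h n = (2 + Real.cos (2 * Real.pi * Real.logb 2 ((max n 1 : ℕ) : ℝ))) / ((max n 1 : ℕ) : ℝ)) (n : ℕ) : 1 / ((max n 1 : ℕ) : ℝ) ≤ h n := by
  rw [hh]
  gcongr
  have := Real.neg_one_le_cos (2 * Real.pi * Real.logb 2 ((max n 1 : ℕ) : ℝ))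
  linarith

/-- Exact discrete scale invariance of the gauge: `h (2n) = h n / 2`. -/
theorem lp_two_mul {h : ℕ → ℝ} (hh : ∀ n : ℕ, h n = (2 + Real.cos (2 * Real.pi * Real.logb 2 ((max n 1 : ℕ) : ℝ))) / ((max n 1 : ℕ) : ℝ)) {n : ℕ} (hn : 1 ≤ n) : h (2 * n) = h n / 2 := by
  rw [lp_of_one_le hh hn, lp_of_one_le hh (by omega)]
  have hn0 : (n : ℝ) ≠ 0 := by exact_mod_cast (by omega : n ≠ 0)
  have hlog : Real.logb 2 ((2 * n : ℕ) : ℝ) = 1 + Real.logb 2 (n : ℝ) := by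
    push_cast
    rw [Real.logb_mul two_ne_zero hn0, Real.logb_self_eq_one one_lt_two]
  rw [hlog, mul_add, mul_one, add_comm (2 * Real.pi), Real.cos_add_two_pi]
  push_cast
  field_simp

/-- On the dyadic tower the gauge is pure: `h (2^j) = 3 / 2^j`. -/
theorem lp_two_pow {h : ℕ → ℝ} (hh : ∀ n : ℕ, h n = (2 + Real.cos (2 * Real.pi * Real.logb 2 ((max n 1 : ℕ) : ℝ))) / ((max n 1 : ℕ) : ℝ)) (j : ℕ) : h (2 ^ j) = 3 / (2 : ℝ) ^ j := by
  rw [lp_of_one_le hh Nat.one_le_two_pow]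
  have hlog : Real.logb 2 ((2 ^ j : ℕ) : ℝ) = j := by
    push_cast
    rw [← Real.rpow_natCast, Real.logb_rpow two_pos (by norm_num)]
  rw [hlog, show 2 * Real.pi * (j : ℝ) = j * (2 * Real.pi) by ring, Real.cos_nat_mul_two_pi]
  push_cast
  norm_num

/-- On the tower `3·2^j` the gauge carries the phase `2π log₂ 3`. -/
theorem lp_three_mul_two_pow {h : ℕ → ℝ} (hh : ∀ n : ℕ, h n = (2 + Real.cos (2 * Real.pi * Real.logb 2 ((max n 1 : ℕ) : ℝ))) / ((max n 1 : ℕ) : ℝ)) (j : ℕ) :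
    h (3 * 2 ^ j) = (2 + Real.cos (2 * Real.pi * Real.logb 2 3)) / (3 * (2 : ℝ) ^ j) := by
  have h1 : 1 ≤ 3 * 2 ^ j := by have := Nat.one_le_two_pow (n := j); omega
  rw [lp_of_one_le hh h1]
  have hlog : Real.logb 2 ((3 * 2 ^ j : ℕ) : ℝ) = Real.logb 2 3 + j := by
    push_cast
    rw [Real.logb_mul (by norm_num) (by positivity), ← Real.rpow_natCast,
      Real.logb_rpow two_pos (by norm_num)]
  rw [hlog, mul_add, show 2 * Real.pi * (j : ℝ) = j * (2 * Real.pi) by ring, Real.cos_add_nat_mul_two_pi]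
  push_cast
  ring

/-! ## The kernel `G x = h ⌊|x|₂⌋` (hypothesis `hG`) -/

/-- W2 on the axis: `G (n e₀) = h n`. -/
theorem lp_single {h : ℕ → ℝ} {G : Site 3 → ℝ} (hG : ∀ x : Site 3, G x = h ⌊Real.sqrt (∑ i, ((x i : ℝ)) ^ 2)⌋₊) (n : ℕ) : G (Pi.single 0 ((n : ℕ) : ℤ)) = h n := by
  rw [hG, floor_sqrt_sum_sq_single_nat]

/-- W2 is positive. -/
theorem lp_G_pos {h : ℕ → ℝ} {G : Site 3 → ℝ} (hh : ∀ n : ℕ, h n = (2 + Real.cos (2 * Real.pi * Real.logb 2 ((max n 1 : ℕ) : ℝ))) / ((max n 1 : ℕ) : ℝ)) (hG : ∀ x : Site 3, G x = h ⌊Real.sqrt (∑ i, ((x i : ℝ)) ^ 2)⌋₊) (x : Site 3) : 0 < G x := by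
  rw [hG]; exact lp_pos hh _

/-- W2 is cubic symmetric. -/
theorem lp_G_symm {h : ℕ → ℝ} {G : Site 3 → ℝ} (hG : ∀ x : Site 3, G x = h ⌊Real.sqrt (∑ i, ((x i : ℝ)) ^ 2)⌋₊) :
    (∀ (σ : Equiv.Perm (Fin 3)) (ε : Fin 3 → ℤ), (∀ i, ε i = 1 ∨ ε i = -1) → ∀ x, G (fun i => ε i * x (σ i)) = G x) := by
  intro σ ε hε x
  rw [hG, hG, sum_sq_symm σ ε hε x]

/-- W2 satisfies ratio isotropy S3 — identically. -/
theorem lp_ratioIsotropy {h : ℕ → ℝ} {G : Site 3 → ℝ} (hh : ∀ n : ℕ, h n = (2 + Real.cos (2 * Real.pi * Real.logb 2 ((max n 1 : ℕ) : ℝ))) / ((max n 1 : ℕ) : ℝ)) (hG : ∀ x : Site 3, G x = h ⌊Real.sqrt (∑ i, ((x i : ℝ)) ^ 2)⌋₊) :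
    Tendsto (fun x : Site 3 => G x / G (Pi.single 0 ((⌊Real.sqrt (∑ i, ((x i : ℝ)) ^ 2)⌋₊ : ℕ) : ℤ))) cofinite (𝓝 1) := by
  refine (tendsto_const_nhds (x := (1 : ℝ))).congr fun x => ?_
  rw [lp_single hG, hG, div_self (lp_pos hh _).ne']

/-- W2 satisfies the angular profile statement A with `Ψ ≡ 1` — identically. -/
theorem lp_angularProfile {h : ℕ → ℝ} {G : Site 3 → ℝ} (hh : ∀ n : ℕ, h n = (2 + Real.cos (2 * Real.pi * Real.logb 2 ((max n 1 : ℕ) : ℝ))) / ((max n 1 : ℕ) : ℝ)) (hG : ∀ x : Site 3, G x = h ⌊Real.sqrt (∑ i, ((x i : ℝ)) ^ 2)⌋₊) :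
    Tendsto (fun x : Site 3 => G x / G (Pi.single 0 ((⌊Real.sqrt (∑ i, ((x i : ℝ)) ^ 2)⌋₊ : ℕ) : ℤ)) - (fun _ : Fin 3 → ℝ => (1 : ℝ)) (fun i => (x i : ℝ) / Real.sqrt (∑ j, ((x j : ℝ)) ^ 2))) cofinite (𝓝 0) := by
  refine (tendsto_const_nhds (x := (0 : ℝ))).congr fun x => ?_
  rw [lp_single hG, hG, div_self (lp_pos hh _).ne', sub_self]

/-- W2 satisfies the dyadic tower law T1 EXACTLY at `Δ = 1/2`, `c = 3`. -/
theorem lp_dyadicTowerLaw {h : ℕ → ℝ} {G : Site 3 → ℝ} (hh : ∀ n : ℕ, h n = (2 + Real.cos (2 * Real.pi * Real.logb 2 ((max n 1 : ℕ) : ℝ))) / ((max n 1 : ℕ) : ℝ)) (hG : ∀ x : Site 3, G x = h ⌊Real.sqrt (∑ i, ((x i : ℝ)) ^ 2)⌋₊) :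
    (∃ Δ c : ℝ, 0 < c ∧ Tendsto (fun j : ℕ => G (Pi.single 0 ((2 ^ j : ℕ) : ℤ)) * ((2 ^ j : ℕ) : ℝ) ^ (2 * Δ)) atTop (𝓝 c)) := by
  refine ⟨1 / 2, 3, by norm_num, ?_⟩
  refine (tendsto_const_nhds (x := (3 : ℝ))).congr fun j => ?_
  rw [lp_single hG, lp_two_pow hh, show (2 : ℝ) * (1 / 2) = 1 by norm_num, Real.rpow_one]
  push_cast
  field_simp

/-- W2 lies in the envelope: `‖x‖⁻²/2 ≤ G x ≤ 6‖x‖⁻¹` off the origin. -/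
theorem lp_envelope {h : ℕ → ℝ} {G : Site 3 → ℝ} (hh : ∀ n : ℕ, h n = (2 + Real.cos (2 * Real.pi * Real.logb 2 ((max n 1 : ℕ) : ℝ))) / ((max n 1 : ℕ) : ℝ)) (hG : ∀ x : Site 3, G x = h ⌊Real.sqrt (∑ i, ((x i : ℝ)) ^ 2)⌋₊) :
    (∃ c C : ℝ, 0 < c ∧ ∀ x : Site 3, x ≠ 0 → c * (‖x‖ : ℝ) ^ (-(2 : ℝ)) ≤ G x ∧ G x ≤ C * (‖x‖ : ℝ) ^ (-(1 : ℝ))) := by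
  refine ⟨1 / 2, 6, by norm_num, fun x hx => ?_⟩
  obtain ⟨hn1, hnr, hrn⟩ := floor_radius_bounds hx
  rw [hG]
  set r := Real.sqrt (∑ i, ((x i : ℝ)) ^ 2) with hr
  set n := ⌊r⌋₊ with hn
  have hx1 : (1 : ℝ) ≤ ‖x‖ := one_le_norm_of_ne_zero hx
  have hxr : ‖x‖ ≤ r := expWin_norm_le_euclid x
  have hr3 : r ≤ Real.sqrt 3 * ‖x‖ := expWin_euclid_le_sqrt_three_mul_norm x
  have hnpos : (0 : ℝ) < n := by exact_mod_cast hn1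
  have hmax : ((max n 1 : ℕ) : ℝ) = n := by rw [max_eq_left hn1]
  have hs3 : Real.sqrt 3 ≤ 2 := by
    rw [Real.sqrt_le_iff]; norm_num
  constructor
  · have h1 : 1 / (n : ℝ) ≤ h n := by simpa only [hmax] using le_lp hh n
    rw [Real.rpow_neg (by linarith), Real.rpow_two]
    calc 1 / 2 * (‖x‖ ^ 2)⁻¹ = 1 / (2 * ‖x‖ * ‖x‖) := by field_simp
      _ ≤ 1 / (Real.sqrt 3 * ‖x‖) := by
          apply one_div_le_one_div_of_le (by positivity)
          nlinarith
      _ ≤ 1 / r := one_div_le_one_div_of_le (by linarith) hr3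
      _ ≤ 1 / (n : ℝ) := one_div_le_one_div_of_le hnpos hnr
      _ ≤ h n := h1
  · have h1 : h n ≤ 3 / (n : ℝ) := by simpa only [hmax] using lp_le hh n
    rw [Real.rpow_neg_one]
    calc h n ≤ 3 / (n : ℝ) := h1
      _ = 6 / (2 * (n : ℝ)) := by field_simp; ring
      _ ≤ 6 / r := div_le_div_of_nonneg_left (by norm_num) (by linarith) hrn
      _ ≤ 6 / ‖x‖ := div_le_div_of_nonneg_left (by norm_num) (by linarith) hxr
      _ = 6 * ‖x‖⁻¹ := by rw [div_eq_mul_inv]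

/-! ## What W2 violates -/

/-- **W2 violates S2 at every exponent**: `k = 2` forces `2Δ = 1`, and then along the dyadic tower the
`k = 3` ratio is the constant `(2 + cos (2π log₂ 3))/3 ≠ 1`. -/
theorem lp_not_integerDilationLaw {h : ℕ → ℝ} {G : Site 3 → ℝ} (hh : ∀ n : ℕ, h n = (2 + Real.cos (2 * Real.pi * Real.logb 2 ((max n 1 : ℕ) : ℝ))) / ((max n 1 : ℕ) : ℝ)) (hG : ∀ x : Site 3, G x = h ⌊Real.sqrt (∑ i, ((x i : ℝ)) ^ 2)⌋₊) (Δ : ℝ) :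
    ¬ (∀ k : ℕ, 1 ≤ k → Tendsto (fun n : ℕ => G (Pi.single 0 ((k * n : ℕ) : ℤ)) * (k : ℝ) ^ (2 * Δ) / G (Pi.single 0 ((n : ℕ) : ℤ))) atTop (𝓝 1)) := by
  intro hS
  -- k = 2 forces 2^(2Δ) = 2
  have h2 := hS 2 (by norm_num)
  have e2 : ∀ n : ℕ, 1 ≤ n → G (Pi.single 0 ((2 * n : ℕ) : ℤ)) * ((2 : ℕ) : ℝ) ^ (2 * Δ) /
      G (Pi.single 0 ((n : ℕ) : ℤ)) = (2 : ℝ) ^ (2 * Δ) / 2 := by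
    intro n hn
    rw [lp_single hG, lp_single hG, lp_two_mul hh hn]
    have := (lp_pos hh n).ne'
    push_cast
    field_simp
  have lim2 : Tendsto (fun n : ℕ => G (Pi.single 0 ((2 * n : ℕ) : ℤ)) * ((2 : ℕ) : ℝ) ^ (2 * Δ) /
      G (Pi.single 0 ((n : ℕ) : ℤ))) atTop (𝓝 ((2 : ℝ) ^ (2 * Δ) / 2)) :=
    tendsto_const_nhds.congr' ((eventually_ge_atTop 1).mono fun n hn => (e2 n hn).symm)
  have key : (2 : ℝ) ^ (2 * Δ) / 2 = 1 := tendsto_nhds_unique lim2 h2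
  have hΔ : 2 * Δ = 1 := by
    refine rpow_two_inj ?_
    rw [Real.rpow_one]
    linarith
  -- k = 3 along the dyadic tower
  have h3 := (hS 3 (by norm_num)).comp (tendsto_pow_atTop_atTop_of_one_lt one_lt_two)
  have e3 : ((fun n : ℕ => G (Pi.single 0 ((3 * n : ℕ) : ℤ)) * ((3 : ℕ) : ℝ) ^ (2 * Δ) /
      G (Pi.single 0 ((n : ℕ) : ℤ))) ∘ fun j : ℕ => 2 ^ j) =
      fun _ => (2 + Real.cos (2 * Real.pi * Real.logb 2 3)) / 3 := by
    funext j
    simp only [Function.comp_apply]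
    rw [lp_single hG, lp_single hG, lp_three_mul_two_pow hh, lp_two_pow hh, hΔ]
    push_cast
    rw [Real.rpow_one]
    field_simp
  rw [e3] at h3
  have h13 := tendsto_nhds_unique h3 tendsto_const_nhds
  apply cos_two_pi_logb_two_three_ne_one
  field_simp at h13
  linarith

/-- **W2 violates the crux shape**: doubling along the axis forces `2Δ = 1`; the towers `2^j` and `3·2^j`
then give the two different limits `3` and `2 + cos (2π log₂ 3)`. -/
theorem lp_not_crux {h : ℕ → ℝ} {G : Site 3 → ℝ} (hh : ∀ n : ℕ, h n = (2 + Real.cos (2 * Real.pi * Real.logb 2 ((max n 1 : ℕ) : ℝ))) / ((max n 1 : ℕ) : ℝ)) (hG : ∀ x : Site 3, G x = h ⌊Real.sqrt (∑ i, ((x i : ℝ)) ^ 2)⌋₊) :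
    ¬ (∃ Δ c : ℝ, 0 < c ∧ Tendsto (fun x : Site 3 => G x * Real.sqrt (∑ i, ((x i : ℝ)) ^ 2) ^ (2 * Δ)) cofinite (𝓝 c)) := by
  rintro ⟨Δ, c, hc, hcof⟩
  have hax : Tendsto (fun n : ℕ => G (Pi.single 0 ((n : ℕ) : ℤ)) * (n : ℝ) ^ (2 * Δ)) atTop (𝓝 c) := by
    refine (tendsto_axis_of_cofinite hcof).congr fun n => ?_
    simp only [sqrt_sum_sq_single_nat]
  -- doubling along the axis
  have hmono : StrictMono fun n : ℕ => 2 * n := fun a b hab => by dsimp only; omega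
  have hd := hax.comp hmono.tendsto_atTop
  have e : ∀ n : ℕ, 1 ≤ n → G (Pi.single 0 ((2 * n : ℕ) : ℤ)) * ((2 * n : ℕ) : ℝ) ^ (2 * Δ) =
      (2 : ℝ) ^ (2 * Δ) / 2 * (G (Pi.single 0 ((n : ℕ) : ℤ)) * (n : ℝ) ^ (2 * Δ)) := by
    intro n hn
    rw [lp_single hG, lp_single hG, lp_two_mul hh hn]
    push_cast
    rw [Real.mul_rpow (by norm_num) (Nat.cast_nonneg n)]
    ring
  have hd' : Tendsto (fun n : ℕ => G (Pi.single 0 ((2 * n : ℕ) : ℤ)) * ((2 * n : ℕ) : ℝ) ^ (2 * Δ))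
      atTop (𝓝 ((2 : ℝ) ^ (2 * Δ) / 2 * c)) :=
    (hax.const_mul _).congr' ((eventually_ge_atTop 1).mono fun n hn => (e n hn).symm)
  have key : (2 : ℝ) ^ (2 * Δ) / 2 * c = c := tendsto_nhds_unique hd' hd
  have hΔ : 2 * Δ = 1 := by
    have h1 : (2 : ℝ) ^ (2 * Δ) / 2 = 1 := mul_right_cancel₀ hc.ne' (key.trans (one_mul c).symm)
    refine rpow_two_inj ?_
    rw [Real.rpow_one]
    linarith
  -- the dyadic tower: value 3
  have t1 := hax.comp (tendsto_pow_atTop_atTop_of_one_lt one_lt_two)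
  have e1 : ((fun n : ℕ => G (Pi.single 0 ((n : ℕ) : ℤ)) * (n : ℝ) ^ (2 * Δ)) ∘ fun j : ℕ => 2 ^ j) =
      fun _ => (3 : ℝ) := by
    funext j
    simp only [Function.comp_apply]
    rw [lp_single hG, lp_two_pow hh, hΔ]
    push_cast
    rw [Real.rpow_one]
    field_simp
  rw [e1] at t1
  have hc3 : c = 3 := tendsto_nhds_unique t1 tendsto_const_nhds
  -- the tower 3·2^j: value 2 + cos (2π log₂ 3)
  have hmono3 : StrictMono fun j : ℕ => 3 * 2 ^ j := fun a b hab => by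
    have : 2 ^ a < 2 ^ b := Nat.pow_lt_pow_right (by norm_num) hab
    dsimp only
    omega
  have t3 := hax.comp hmono3.tendsto_atTop
  have e3 : ((fun n : ℕ => G (Pi.single 0 ((n : ℕ) : ℤ)) * (n : ℝ) ^ (2 * Δ)) ∘ fun j : ℕ => 3 * 2 ^ j) =
      fun _ => 2 + Real.cos (2 * Real.pi * Real.logb 2 3) := by
    funext j
    simp only [Function.comp_apply]
    rw [lp_single hG, lp_three_mul_two_pow hh, hΔ]
    push_cast
    rw [Real.rpow_one]
    field_simp
  rw [e3] at t3
  have hc' : c = 2 + Real.cos (2 * Real.pi * Real.logb 2 3) := tendsto_nhds_unique t3 tendsto_const_nhds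
  exact cos_two_pi_logb_two_three_ne_one (by linarith)

/-! ## The separations (F2) -/

/-- **F2a — S2 is not implied by T1 ∧ S3 ∧ A ∧ envelope ∧ symmetry ∧ positivity.** For functions
`G : ℤ³ → ℝ`: positivity, cubic symmetry, the envelope `c‖x‖⁻² ≤ G ≤ C‖x‖⁻¹`, the dyadic tower law T1,
ratio isotropy S3 and the angular profile statement A (with `Ψ ≡ 1`) together do NOT imply the integer dilation
law S2 at any exponent (witness W2). [folklore: log-periodic gauge, discrete scale invariance] -/
theorem lp_integerDilationLaw_not_of_tower_isotropy_envelope :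
    ¬ ∀ G : Site 3 → ℝ, (∀ x, 0 < G x) →
      (∀ (σ : Equiv.Perm (Fin 3)) (ε : Fin 3 → ℤ), (∀ i, ε i = 1 ∨ ε i = -1) → ∀ x, G (fun i => ε i * x (σ i)) = G x) →
      (∃ c C : ℝ, 0 < c ∧ ∀ x : Site 3, x ≠ 0 → c * (‖x‖ : ℝ) ^ (-(2 : ℝ)) ≤ G x ∧ G x ≤ C * (‖x‖ : ℝ) ^ (-(1 : ℝ))) →
      (∃ Δ c : ℝ, 0 < c ∧ Tendsto (fun j : ℕ => G (Pi.single 0 ((2 ^ j : ℕ) : ℤ)) * ((2 ^ j : ℕ) : ℝ) ^ (2 * Δ)) atTop (𝓝 c)) →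
      Tendsto (fun x : Site 3 => G x / G (Pi.single 0 ((⌊Real.sqrt (∑ i, ((x i : ℝ)) ^ 2)⌋₊ : ℕ) : ℤ))) cofinite (𝓝 1) →
      Tendsto (fun x : Site 3 => G x / G (Pi.single 0 ((⌊Real.sqrt (∑ i, ((x i : ℝ)) ^ 2)⌋₊ : ℕ) : ℤ)) - (fun _ : Fin 3 → ℝ => (1 : ℝ)) (fun i => (x i : ℝ) / Real.sqrt (∑ j, ((x j : ℝ)) ^ 2))) cofinite (𝓝 0) →
      ∃ Δ : ℝ, (∀ k : ℕ, 1 ≤ k → Tendsto (fun n : ℕ => G (Pi.single 0 ((k * n : ℕ) : ℤ)) * (k : ℝ) ^ (2 * Δ) / G (Pi.single 0 ((n : ℕ) : ℤ))) atTop (𝓝 1)) := by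
  intro hall
  set h : ℕ → ℝ := fun n => (2 + Real.cos (2 * Real.pi * Real.logb 2 ((max n 1 : ℕ) : ℝ))) / ((max n 1 : ℕ) : ℝ)
    with hh_def
  set G : Site 3 → ℝ := fun x => h ⌊Real.sqrt (∑ i, ((x i : ℝ)) ^ 2)⌋₊ with hG_def
  have hh : ∀ n : ℕ, h n = (2 + Real.cos (2 * Real.pi * Real.logb 2 ((max n 1 : ℕ) : ℝ))) / ((max n 1 : ℕ) : ℝ) :=
    fun n => rfl
  have hG : ∀ x : Site 3, G x = h ⌊Real.sqrt (∑ i, ((x i : ℝ)) ^ 2)⌋₊ := fun x => rfl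
  obtain ⟨Δ, hΔ⟩ := hall G (lp_G_pos hh hG) (lp_G_symm hG) (lp_envelope hh hG) (lp_dyadicTowerLaw hh hG)
    (lp_ratioIsotropy hh hG) (lp_angularProfile hh hG)
  exact lp_not_integerDilationLaw hh hG Δ hΔ

/-- **F2b — the crux shape is not implied by T1 ∧ S3 ∧ A ∧ envelope ∧ symmetry ∧ positivity** (witness W2).
Since `crux_iff`-wise the crux IS this shape at `G := criticalTwoPoint 3`, a proof of the crux along line
`tower_profile_rigidity` must put Ising-specific content into S2 / Sray. [folklore] -/
theorem lp_crux_not_of_tower_isotropy_envelope :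
    ¬ ∀ G : Site 3 → ℝ, (∀ x, 0 < G x) →
      (∀ (σ : Equiv.Perm (Fin 3)) (ε : Fin 3 → ℤ), (∀ i, ε i = 1 ∨ ε i = -1) → ∀ x, G (fun i => ε i * x (σ i)) = G x) →
      (∃ c C : ℝ, 0 < c ∧ ∀ x : Site 3, x ≠ 0 → c * (‖x‖ : ℝ) ^ (-(2 : ℝ)) ≤ G x ∧ G x ≤ C * (‖x‖ : ℝ) ^ (-(1 : ℝ))) →
      (∃ Δ c : ℝ, 0 < c ∧ Tendsto (fun j : ℕ => G (Pi.single 0 ((2 ^ j : ℕ) : ℤ)) * ((2 ^ j : ℕ) : ℝ) ^ (2 * Δ)) atTop (𝓝 c)) →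
      Tendsto (fun x : Site 3 => G x / G (Pi.single 0 ((⌊Real.sqrt (∑ i, ((x i : ℝ)) ^ 2)⌋₊ : ℕ) : ℤ))) cofinite (𝓝 1) →
      Tendsto (fun x : Site 3 => G x / G (Pi.single 0 ((⌊Real.sqrt (∑ i, ((x i : ℝ)) ^ 2)⌋₊ : ℕ) : ℤ)) - (fun _ : Fin 3 → ℝ => (1 : ℝ)) (fun i => (x i : ℝ) / Real.sqrt (∑ j, ((x j : ℝ)) ^ 2))) cofinite (𝓝 0) →
      (∃ Δ c : ℝ, 0 < c ∧ Tendsto (fun x : Site 3 => G x * Real.sqrt (∑ i, ((x i : ℝ)) ^ 2) ^ (2 * Δ)) cofinite (𝓝 c)) := by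
  intro hall
  set h : ℕ → ℝ := fun n => (2 + Real.cos (2 * Real.pi * Real.logb 2 ((max n 1 : ℕ) : ℝ))) / ((max n 1 : ℕ) : ℝ)
    with hh_def
  set G : Site 3 → ℝ := fun x => h ⌊Real.sqrt (∑ i, ((x i : ℝ)) ^ 2)⌋₊ with hG_def
  have hh : ∀ n : ℕ, h n = (2 + Real.cos (2 * Real.pi * Real.logb 2 ((max n 1 : ℕ) : ℝ))) / ((max n 1 : ℕ) : ℝ) :=
    fun n => rfl
  have hG : ∀ x : Site 3, G x = h ⌊Real.sqrt (∑ i, ((x i : ℝ)) ^ 2)⌋₊ := fun x => rfl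
  exact lp_not_crux hh hG (hall G (lp_G_pos hh hG) (lp_G_symm hG) (lp_envelope hh hG) (lp_dyadicTowerLaw hh hG)
    (lp_ratioIsotropy hh hG) (lp_angularProfile hh hG))

end Summit.CriticalPhenomena.Ising3DConformalLimit.Theorems.IsingEuclidUpgradeR2RotInvPowerLaw.Negative

end
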